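import Literature.Geometry.DiscreteGeometry.SphericalExcessEuler
import HarnessLib

/-!
# The spherical excess as a function of the sides, II: sine formula, the regular triangle,
# the solid angle, and the dependence on one side (Euler 1781, Lexell 1784) — proved

Topic `Literature/Geometry/DiscreteGeometry`; continuation of `SphericalExcessEuler.lean`
(Euler's formula `1 − cos E = F(x,y,z) = D/((1+x)(1+y)(1+z))` for the excess `E = sphExcess a b c`
of the triangle of unit vectors `a, b, c`, `x = ⟪b,c⟫, y = ⟪a,c⟫, z = ⟪a,b⟫`,
`D = 1 − x² − y² − z² + 2xyz`).

* `sin_sphExcess`: `sin E = (1+x+y+z) √D / ((1+x)(1+y)(1+z))` (with Euler's formula this is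
  `tan (E/2) = √D/(1+x+y+z)`, the Euler–Lagrange / Van Oosterom–Strackee form).
* `sphExcess_swap₁₂/₂₃`, `sphExcess_rotate`: symmetry of the excess in the three vertices.
* `angle_perpTo_eq_arccos_third`, `sphExcess_of_inner_eq_half`: the regular triangle of side
  `π/3` has angles `arccos (1/3)` and excess `3 arccos (1/3) − π` (Hales's `sol₀`;
  `eulerF_half`: `F(½,½,½) = 4/27`, i.e. `cos sol₀ = 23/27`).
* `sphExcess_eq_four_pi_mul_solidAngleFraction` (`ℝ³`, Girard), `sphExcess_nonneg`, and
  `le_sphExcess_of_one_sub_cos_le`: a lower bound `1 − cos E₀ ≤ F` with `E₀ ≤ π` gives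
  `E₀ ≤ E` — every area estimate from the sides becomes a polynomial inequality.
* **Dependence on one side** — `eulerF_sub_eulerF`:
  `F(x,y,z₂) − F(x,y,z₁) = (z₂ − z₁)((x+y)² − (1+z₁)(1+z₂)) / ((1+x)(1+y)(1+z₁)(1+z₂))`; so in
  each side separately the area first increases, then decreases (Lexell: for fixed `a, b` the
  area is stationary exactly on `(1 + cos c)² = (cos a + cos b)²`), on any interval of one
  side-cosine the MINIMUM of `F` is at an endpoint (`min_eulerF_le₁/₂/₃`), and on a box of
  side-cosines a common lower bound at the corners holds everywhere
  (`le_eulerF_of_corners₂`, `le_eulerF_of_corners₃`) — the form in which Hales's Lexell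
  arguments ("the area … does not have an interior point local minimum … each edge length is
  extremal", arXiv:1209.6043 Remark 1) are carried out in `KissingMainEstimate.lean`.

Everything is PROVED; no named facts.

## References
* L. Euler, *De mensura angulorum solidorum*, Acta Acad. Petrop. 2 (1781) 31–54; A. J. Lexell,
  *Solutio problematis geometrici ex doctrina sphaericorum*, Acta Acad. Petrop. 5 (1784);
  I. Todhunter, J. G. Leathem, *Spherical Trigonometry* (1914), Arts. 102–103. [folklore]
* T. C. Hales, arXiv:1209.6043 (2012), Remark 1 (Lexell's theorem) and §4 (`sol₀`).
  [`Hales2012`]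
-/

noncomputable section

namespace Literature.Geometry.DiscreteGeometry

open Real RealInnerProductSpace InnerProductGeometry

/-! ### Part A. The sine of the excess; the regular triangle -/

section Unit

variable {F : Type*} [NormedAddCommGroup F] [InnerProductSpace ℝ F]

/-- **The sine of the excess**: `sin E = (1 + x + y + z) √D / ((1+x)(1+y)(1+z))` — the companion
of Euler's formula (together they give `tan (E/2) = √D/(1 + x + y + z)`, the Van Oosterom–
Strackee / Euler–Lagrange form).  Same proof, expanding `sin (A + B + C)`. [folklore] -/
theorem sin_sphExcess {a b c : F} (ha : ‖a‖ = 1) (hb : ‖b‖ = 1) (hc : ‖c‖ = 1)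
    (hli : LinearIndependent ℝ ![a, b, c]) :
    Real.sin (sphExcess a b c) =
      (1 + ⟪b, c⟫ + ⟪a, c⟫ + ⟪a, b⟫) * Real.sqrt (eulerGram ⟪b, c⟫ ⟪a, c⟫ ⟪a, b⟫) /
        ((1 + ⟪b, c⟫) * (1 + ⟪a, c⟫) * (1 + ⟪a, b⟫)) := by
  -- notation
  set x := ⟪b, c⟫ with hx
  set y := ⟪a, c⟫ with hy
  set z := ⟪a, b⟫ with hz
  set A := angle (perpTo a b) (perpTo a c) with hA
  set B := angle (perpTo b a) (perpTo b c) with hB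
  set C := angle (perpTo c a) (perpTo c b) with hC
  have hz1 : z ^ 2 < 1 :=
    inner_sq_lt_one_of_linearIndependent ha hb (linearIndependent_pair_of_triple₁₂ hli)
  have hy1 : y ^ 2 < 1 :=
    inner_sq_lt_one_of_linearIndependent ha hc (linearIndependent_pair_of_triple₁₃ hli)
  have hx1 : x ^ 2 < 1 :=
    inner_sq_lt_one_of_linearIndependent hb hc (linearIndependent_pair_of_triple₂₃ hli)
  have hxb := abs_lt.1 ((sq_lt_one_iff_abs_lt_one x).1 hx1)
  have hyb := abs_lt.1 ((sq_lt_one_iff_abs_lt_one y).1 hy1)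
  have hzb := abs_lt.1 ((sq_lt_one_iff_abs_lt_one z).1 hz1)
  set nab := ‖perpTo a b‖ with hnab
  set nac := ‖perpTo a c‖ with hnac
  set nbc := ‖perpTo b c‖ with hnbc
  have eba : ‖perpTo b a‖ = nab := (norm_perpTo_comm_of_norm_eq_one ha hb).symm
  have eca : ‖perpTo c a‖ = nac := (norm_perpTo_comm_of_norm_eq_one ha hc).symm
  have ecb : ‖perpTo c b‖ = nbc := (norm_perpTo_comm_of_norm_eq_one hb hc).symm
  have sab : nab ^ 2 = 1 - z ^ 2 := norm_perpTo_sq_of_norm_eq_one ha hb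
  have sac : nac ^ 2 = 1 - y ^ 2 := norm_perpTo_sq_of_norm_eq_one ha hc
  have sbc : nbc ^ 2 = 1 - x ^ 2 := norm_perpTo_sq_of_norm_eq_one hb hc
  set D := eulerGram x y z with hD
  have hD0 : 0 ≤ D := eulerGram_inner_nonneg ha hb hc
  set r := Real.sqrt D with hr
  have hrr : r * r = D := Real.mul_self_sqrt hD0
  have cA : Real.cos A * (nab * nac) = x - z * y := by
    rw [hA, cos_angle_perpTo_mul ha]
  have sA : Real.sin A * (nab * nac) = r := by
    rw [hA, sin_angle_perpTo_mul ha hb hc]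
  have cB : Real.cos B * (nab * nbc) = y - z * x := by
    rw [hB, ← eba, cos_angle_perpTo_mul hb, real_inner_comm a b]
  have sB : Real.sin B * (nab * nbc) = r := by
    rw [hB, ← eba, sin_angle_perpTo_mul hb ha hc, real_inner_comm a b, hr, hD,
      eulerGram_swap₁₂]
  have cC : Real.cos C * (nac * nbc) = z - y * x := by
    rw [hC, ← eca, ← ecb, cos_angle_perpTo_mul hc, real_inner_comm a c, real_inner_comm b c]
  have sC : Real.sin C * (nac * nbc) = r := by
    rw [hC, ← eca, ← ecb, sin_angle_perpTo_mul hc ha hb, real_inner_comm a c,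
      real_inner_comm b c, hr, hD,
      show eulerGram z x y = eulerGram x y z by unfold eulerGram; ring]
  have hE : sphExcess a b c = A + B + C - π := by rw [hA, hB, hC, sphExcess]
  have hsinE : Real.sin (sphExcess a b c) =
      -((Real.sin A * Real.cos B + Real.cos A * Real.sin B) * Real.cos C +
        (Real.cos A * Real.cos B - Real.sin A * Real.sin B) * Real.sin C) := by
    rw [hE, Real.sin_sub_pi, Real.sin_add, Real.cos_add, Real.sin_add]
  have hN : (nab * nac) * (nab * nbc) * (nac * nbc) = (1 - z ^ 2) * (1 - y ^ 2) * (1 - x ^ 2) := by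
    rw [← sab, ← sac, ← sbc]; ring
  have key : Real.sin (sphExcess a b c) * ((1 - z ^ 2) * (1 - y ^ 2) * (1 - x ^ 2)) =
      r * (1 + x + y + z) * ((1 - x) * (1 - y) * (1 - z)) := by
    rw [hsinE, ← hN]
    have e1 : -((Real.sin A * Real.cos B + Real.cos A * Real.sin B) * Real.cos C +
          (Real.cos A * Real.cos B - Real.sin A * Real.sin B) * Real.sin C) *
          ((nab * nac) * (nab * nbc) * (nac * nbc)) =
        -((Real.sin A * (nab * nac)) * (Real.cos B * (nab * nbc)) * (Real.cos C * (nac * nbc)) +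
          (Real.cos A * (nab * nac)) * (Real.sin B * (nab * nbc)) * (Real.cos C * (nac * nbc)) +
          (Real.cos A * (nab * nac)) * (Real.cos B * (nab * nbc)) * (Real.sin C * (nac * nbc)) -
          (Real.sin A * (nab * nac)) * (Real.sin B * (nab * nbc)) * (Real.sin C * (nac * nbc))) := by
      ring
    rw [e1, cA, sA, cB, sB, cC, sC]
    have hD' : D = 1 - x ^ 2 - y ^ 2 - z ^ 2 + 2 * x * y * z := by rw [hD, eulerGram]
    linear_combination r * hrr + r * hD'
  have hQ : 0 < (1 + x) * (1 + y) * (1 + z) :=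
    mul_pos (mul_pos (by linarith) (by linarith)) (by linarith)
  have hQ' : 0 < (1 - x) * (1 - y) * (1 - z) :=
    mul_pos (mul_pos (by linarith) (by linarith)) (by linarith)
  have e2 : (1 - z ^ 2) * (1 - y ^ 2) * (1 - x ^ 2) =
      ((1 + x) * (1 + y) * (1 + z)) * ((1 - x) * (1 - y) * (1 - z)) := by ring
  rw [e2, ← mul_assoc] at key
  have key' := mul_right_cancel₀ hQ'.ne' key
  rw [eq_div_iff hQ.ne', key']
  ring

/-- The excess is symmetric: swapping the first two vertices. [folklore] -/
theorem sphExcess_swap₁₂ (a b c : F) : sphExcess b a c = sphExcess a b c := by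
  unfold sphExcess
  rw [angle_comm (perpTo c b) (perpTo c a)]
  ring

/-- The excess is symmetric: swapping the last two vertices. [folklore] -/
theorem sphExcess_swap₂₃ (a b c : F) : sphExcess a c b = sphExcess a b c := by
  unfold sphExcess
  rw [angle_comm (perpTo a c) (perpTo a b), angle_comm (perpTo c a) (perpTo c b),
    angle_comm (perpTo b a) (perpTo b c)]
  ring

/-- The excess is symmetric: cyclic rotation of the vertices. [folklore] -/
theorem sphExcess_rotate (a b c : F) : sphExcess b c a = sphExcess a b c := by
  rw [sphExcess_swap₂₃ b a c, sphExcess_swap₁₂ a b c]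

/-- **Each angle of the equilateral spherical triangle of side `π/3` is `arccos (1/3)`** (the
dihedral angle of the regular tetrahedron): if `⟪a, b⟫ = ⟪a, c⟫ = ⟪b, c⟫ = 1/2` for unit
vectors then `∠(perpTo a b, perpTo a c) = arccos (1/3)`. [folklore] -/
theorem angle_perpTo_eq_arccos_third {a b c : F} (ha : ‖a‖ = 1) (hb : ‖b‖ = 1) (hc : ‖c‖ = 1)
    (hab : ⟪a, b⟫ = 1 / 2) (hac : ⟪a, c⟫ = 1 / 2) (hbc : ⟪b, c⟫ = 1 / 2) :
    angle (perpTo a b) (perpTo a c) = Real.arccos (1 / 3) := by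
  have h1 : ‖perpTo a b‖ ^ 2 = 3 / 4 := by rw [norm_perpTo_sq_of_norm_eq_one ha hb, hab]; norm_num
  have h2 : ‖perpTo a c‖ ^ 2 = 3 / 4 := by rw [norm_perpTo_sq_of_norm_eq_one ha hc, hac]; norm_num
  have h12 : ‖perpTo a b‖ = ‖perpTo a c‖ :=
    (pow_left_inj₀ (norm_nonneg _) (norm_nonneg _) two_ne_zero).1 (h1.trans h2.symm)
  have hprod : ‖perpTo a b‖ * ‖perpTo a c‖ = 3 / 4 := by rw [h12, ← sq, h2]
  have hcos : Real.cos (angle (perpTo a b) (perpTo a c)) = 1 / 3 := by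
    have h := cos_angle_perpTo_mul ha b c
    rw [hprod, hbc, hab, hac] at h
    linarith
  rw [← hcos, Real.arccos_cos (angle_nonneg _ _) (angle_le_pi _ _)]

/-- **The excess of the equilateral triangle of side `π/3`** — the solid angle `sol₀` of Hales
2012 — is `3 arccos (1/3) − π` (`≈ 0.5513`; also `= arccos (23/27)`, cf.
`three_mul_arccos_third` in `KissingCornerBounds.lean`). [cite: Hales2012, §4 (definition of
sol₀)] -/
theorem sphExcess_of_inner_eq_half {a b c : F} (ha : ‖a‖ = 1) (hb : ‖b‖ = 1) (hc : ‖c‖ = 1)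
    (hab : ⟪a, b⟫ = 1 / 2) (hac : ⟪a, c⟫ = 1 / 2) (hbc : ⟪b, c⟫ = 1 / 2) :
    sphExcess a b c = 3 * Real.arccos (1 / 3) - π := by
  have hba : ⟪b, a⟫ = 1 / 2 := by rw [real_inner_comm]; exact hab
  have hca : ⟪c, a⟫ = 1 / 2 := by rw [real_inner_comm]; exact hac
  have hcb : ⟪c, b⟫ = 1 / 2 := by rw [real_inner_comm]; exact hbc
  rw [sphExcess, angle_perpTo_eq_arccos_third ha hb hc hab hac hbc,
    angle_perpTo_eq_arccos_third hb ha hc hba hbc hac,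
    angle_perpTo_eq_arccos_third hc ha hb hca hcb hab]
  ring

end Unit

/-! ### Part B. The excess as a solid angle (`ℝ³`) and lower bounds from Euler's function -/

section Solid

local notation "E3" => EuclideanSpace ℝ (Fin 3)

/-- **`E = 4π · sol/4π`**: the excess is `4π` times the normalised solid angle of the cone
`cone(a, b, c)` (Girard's theorem, `solidAngleFraction_eq_girard`). [cite: HalesDSP2012,
Lemma 3.23] -/
theorem sphExcess_eq_four_pi_mul_solidAngleFraction {a b c : E3}
    (hli : LinearIndependent ℝ ![a, b, c]) :
    sphExcess a b c = 4 * π * solidAngleFraction 0 ![a, b, c] := by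
  rw [solidAngleFraction_eq_girard 0 ![a, b, c] hli]
  simp only [Matrix.cons_val_zero, Matrix.cons_val_one, Matrix.cons_val_two, Matrix.tail_cons,
    Matrix.head_cons, sphExcess]
  field_simp

/-- **The excess is nonnegative** (`ℝ³`; the area of a spherical triangle). [folklore] -/
theorem sphExcess_nonneg {a b c : E3} (hli : LinearIndependent ℝ ![a, b, c]) :
    0 ≤ sphExcess a b c := by
  rw [sphExcess_eq_four_pi_mul_solidAngleFraction hli]
  have := (solidAngleFraction_mem_Icc 0 ![a, b, c]).1
  positivity

/-- **Lower bounds for the excess from Euler's function.**  If `E₀ ≤ π` and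
`1 − cos E₀ ≤ F(x, y, z)` at the side-cosines of the triangle, then `E₀ ≤ E`: for `E ≤ π` this
is the monotonicity of `cos` on `[0, π]` and Euler's formula `cos E = 1 − F`, and for `E > π`
there is nothing to prove.  This turns every area estimate into a polynomial inequality.
[folklore] -/
theorem le_sphExcess_of_one_sub_cos_le {a b c : E3} (ha : ‖a‖ = 1) (hb : ‖b‖ = 1)
    (hc : ‖c‖ = 1) (hli : LinearIndependent ℝ ![a, b, c]) {E₀ : ℝ} (hπ : E₀ ≤ π)
    (h : 1 - Real.cos E₀ ≤ eulerF ⟪b, c⟫ ⟪a, c⟫ ⟪a, b⟫) : E₀ ≤ sphExcess a b c := by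
  by_contra hlt
  have hlt' : sphExcess a b c < E₀ := lt_of_not_ge hlt
  have hcos := Real.cos_lt_cos_of_nonneg_of_le_pi (sphExcess_nonneg hli) hπ hlt'
  rw [← one_sub_cos_sphExcess ha hb hc hli] at h
  linarith

end Solid

/-! ### Part C. Dependence on one side: the difference formula and minima on boxes -/

/-- **The difference formula for Euler's function in its last variable**:
`F(x,y,z₂) − F(x,y,z₁) = (z₂ − z₁)((x + y)² − (1 + z₁)(1 + z₂)) / ((1+x)(1+y)(1+z₁)(1+z₂))`
(from `D = −(1+z)(z − 1 − 2xy) − (x+y)²`, i.e. `F = ((1 + 2xy − z) − (x+y)²/(1+z))/((1+x)(1+y))`).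
Consequently, as the side `c` grows (`z = cos c` decreases) the area increases while
`(1 + z)² > (x + y)²` and decreases afterwards — Lexell's theorem in monotonicity form: for fixed
`a, b` the area is extremal exactly when `cos c = cos a + cos b − 1` or its mirror. [folklore] -/
theorem eulerF_sub_eulerF {x y z₁ z₂ : ℝ} (hx : 1 + x ≠ 0) (hy : 1 + y ≠ 0) (h₁ : 1 + z₁ ≠ 0)
    (h₂ : 1 + z₂ ≠ 0) :
    eulerF x y z₂ - eulerF x y z₁ =
      (z₂ - z₁) * ((x + y) ^ 2 - (1 + z₁) * (1 + z₂)) /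
        ((1 + x) * (1 + y) * (1 + z₁) * (1 + z₂)) := by
  unfold eulerF eulerGram
  field_simp
  ring

/-- **On an interval in one side-cosine, Euler's function is smallest at an endpoint** (it is
unimodal with an interior maximum): for `z₁ ≤ z ≤ z₂` (all `> −1`, and `x, y > −1`),
`min (F(x,y,z₁)) (F(x,y,z₂)) ≤ F(x,y,z)`. [folklore] -/
theorem min_eulerF_le₃ {x y z z₁ z₂ : ℝ} (hx : -1 < x) (hy : -1 < y) (hz₁ : -1 < z₁)
    (h₁ : z₁ ≤ z) (h₂ : z ≤ z₂) :
    min (eulerF x y z₁) (eulerF x y z₂) ≤ eulerF x y z := by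
  have hz : -1 < z := by linarith
  have hz₂ : -1 < z₂ := by linarith
  have hP : 0 < (1 + x) * (1 + y) := mul_pos (by linarith) (by linarith)
  rcases le_or_gt 0 ((x + y) ^ 2 - (1 + z₁) * (1 + z)) with hcase | hcase
  · -- increasing from `z₁` to `z`
    have hd := eulerF_sub_eulerF (z₁ := z₁) (z₂ := z) (x := x) (y := y) (by linarith)
      (by linarith) (by linarith) (by linarith)
    have hnonneg : 0 ≤ eulerF x y z - eulerF x y z₁ := by
      rw [hd]
      apply div_nonneg (mul_nonneg (by linarith) hcase)
      exact (mul_pos (mul_pos hP (by linarith)) (by linarith)).le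
    exact (min_le_left _ _).trans (by linarith)
  · -- decreasing from `z` to `z₂`
    have hlt : (x + y) ^ 2 - (1 + z) * (1 + z₂) < 0 := by
      have : (1 + z₁) * (1 + z) ≤ (1 + z) * (1 + z₂) := by nlinarith
      linarith
    have hd := eulerF_sub_eulerF (z₁ := z) (z₂ := z₂) (x := x) (y := y) (by linarith)
      (by linarith) (by linarith) (by linarith)
    have hnonpos : eulerF x y z₂ - eulerF x y z ≤ 0 := by
      rw [hd]
      apply div_nonpos_of_nonpos_of_nonneg (mul_nonpos_of_nonneg_of_nonpos (by linarith) hlt.le)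
      exact (mul_pos (mul_pos hP (by linarith)) (by linarith)).le
    exact (min_le_right _ _).trans (by linarith)

/-- The endpoint principle in the second variable. [folklore] -/
theorem min_eulerF_le₂ {x y z y₁ y₂ : ℝ} (hx : -1 < x) (hz : -1 < z) (hy₁ : -1 < y₁)
    (h₁ : y₁ ≤ y) (h₂ : y ≤ y₂) :
    min (eulerF x y₁ z) (eulerF x y₂ z) ≤ eulerF x y z := by
  rw [eulerF_swap₂₃ x z y₁, eulerF_swap₂₃ x z y₂, eulerF_swap₂₃ x z y]
  exact min_eulerF_le₃ hx hz hy₁ h₁ h₂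

/-- The endpoint principle in the first variable. [folklore] -/
theorem min_eulerF_le₁ {x y z x₁ x₂ : ℝ} (hy : -1 < y) (hz : -1 < z) (hx₁ : -1 < x₁)
    (h₁ : x₁ ≤ x) (h₂ : x ≤ x₂) :
    min (eulerF x₁ y z) (eulerF x₂ y z) ≤ eulerF x y z := by
  rw [eulerF_swap₁₂ y x₁ z, eulerF_swap₁₂ y x₂ z, eulerF_swap₁₂ y x z]
  exact min_eulerF_le₂ hy hz hx₁ h₁ h₂

/-- **Corner principle, two free sides**: on a box `x ∈ [x₁, x₂]`, `y ∈ [y₁, y₂]` (all `> −1`)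
with the third cosine `z > −1` fixed, a common lower bound at the four corners is a lower bound
everywhere. [folklore] -/
theorem le_eulerF_of_corners₂ {x y z x₁ x₂ y₁ y₂ m : ℝ} (hz : -1 < z) (hx₁ : -1 < x₁)
    (hy₁ : -1 < y₁) (hx : x₁ ≤ x ∧ x ≤ x₂) (hy : y₁ ≤ y ∧ y ≤ y₂)
    (hm : ∀ x' ∈ ({x₁, x₂} : Set ℝ), ∀ y' ∈ ({y₁, y₂} : Set ℝ), m ≤ eulerF x' y' z) :
    m ≤ eulerF x y z := by
  have hxgt : -1 < x := by linarith [hx.1]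
  have hygt : -1 < y := by linarith [hy.1]
  have k₁ : m ≤ eulerF x₁ y z :=
    (le_min (hm x₁ (by simp) y₁ (by simp)) (hm x₁ (by simp) y₂ (by simp))).trans
      (min_eulerF_le₂ hx₁ hz hy₁ hy.1 hy.2)
  have k₂ : m ≤ eulerF x₂ y z :=
    (le_min (hm x₂ (by simp) y₁ (by simp)) (hm x₂ (by simp) y₂ (by simp))).trans
      (min_eulerF_le₂ (by linarith [hx.1, hx.2]) hz hy₁ hy.1 hy.2)
  exact (le_min k₁ k₂).trans (min_eulerF_le₁ hygt hz hx₁ hx.1 hx.2)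

/-- **Corner principle, three free sides**: on a box of side-cosines (all `> −1`) a common lower
bound at the eight corners is a lower bound everywhere. [folklore] -/
theorem le_eulerF_of_corners₃ {x y z x₁ x₂ y₁ y₂ z₁ z₂ m : ℝ} (hx₁ : -1 < x₁) (hy₁ : -1 < y₁)
    (hz₁ : -1 < z₁) (hx : x₁ ≤ x ∧ x ≤ x₂) (hy : y₁ ≤ y ∧ y ≤ y₂) (hz : z₁ ≤ z ∧ z ≤ z₂)
    (hm : ∀ x' ∈ ({x₁, x₂} : Set ℝ), ∀ y' ∈ ({y₁, y₂} : Set ℝ), ∀ z' ∈ ({z₁, z₂} : Set ℝ),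
      m ≤ eulerF x' y' z') :
    m ≤ eulerF x y z := by
  have hxgt : -1 < x := by linarith [hx.1]
  have hygt : -1 < y := by linarith [hy.1]
  have k₁ : m ≤ eulerF x y z₁ :=
    le_eulerF_of_corners₂ hz₁ hx₁ hy₁ hx hy fun x' hx' y' hy' => hm x' hx' y' hy' z₁ (by simp)
  have k₂ : m ≤ eulerF x y z₂ :=
    le_eulerF_of_corners₂ (by linarith [hz.1, hz.2]) hx₁ hy₁ hx hy
      fun x' hx' y' hy' => hm x' hx' y' hy' z₂ (by simp)
  exact (le_min k₁ k₂).trans (min_eulerF_le₃ hxgt hygt hz₁ hz.1 hz.2)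

/-- **Euler's function at the regular tetrahedral corner**: `F(½, ½, ½) = 4/27`, i.e.
`cos sol₀ = 23/27`. [folklore] -/
theorem eulerF_half : eulerF (1 / 2) (1 / 2) (1 / 2) = 4 / 27 := by
  norm_num [eulerF, eulerGram]


end Literature.Geometry.DiscreteGeometry

end
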